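import Summits.CriticalPhenomena.PercolationContinuityZ3.Theorems.PercNearOneGluingAdditiveGluingGluingLemma5
import Summits.CriticalPhenomena.PercolationContinuityZ3.Theorems.PercNearOneGluingNearOneGluingDepthOneGluing
import HarnessLib

/-! # Crux `PercNearOneGluing.AdditiveGluing` (stmt-CriticalPhenomena-4576) — the MULTI-EDGE form of Kozma–Nitzan's Lemma 3(i)
# (strategy (b), correlation inequalities; = the "averaged Lemma 5" AL5 of the lead's LeadMath-c5 §J3 at `|S| = 1`)

Support file (`--supports stmt-CriticalPhenomena-4576`); no definitions, no named facts.

`μ_w = prodBernoulli w` on the bond configurations of the weighted complete graph `Fin n`, `b` the target,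
`τ(v) = μ_w(v ↔ b)`.  Kozma–Nitzan's Lemma 3(i) says: if `τ(d) ≤ τ(a)` and `Q` is increasing and determined by
the open edge cluster of `a`, then `μ(Q, d ↔ b) ≤ μ(Q, a ↔ b)`; with `Q = {the edge x–a is open}` this reads
`μ(x–a open, d ↔ b) ≤ μ(x–a open, x ↔ b)`.  The theorem of this file (`multiEdge_lemma3`) is the UNION version
over several edges at the same vertex `x`:

**Theorem (multi-edge Lemma 3).**  Let `x, d, b` be vertices, `T ∌ x` a finite set of vertices with
`τ(d) ≤ τ(a)` for every `a ∈ T`, and `R = {ω | some edge x–a, a ∈ T, is open}`.  Then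
`μ_w(R ∩ {d ↔ b}) ≤ μ_w(R ∩ {x ↔ b})`.

Equivalently ("deficit contraction"): `τ(d) − τ(x) ≤ μ_w(Rᶜ) · [τ⁰(d) − τ⁰(x)]` for the weighting `w⁰` with
the edges `x–T` removed.  No relay set, no minimality of `d` beyond the edges of `R` is assumed.  For `T` =
the relay neighbours of a non-relay vertex `x'` and `d = a₀` the global minimiser this is exactly the lead's
conjectured inequality AL5 / `X1(x') ≥ 0` ("`WIN_{R₁}(a₀) ≥ LOSE_{R₁}(a₀)`", LeadMath-c5 §J3, 0 failures in
≈ 30 000 blocks, "the unweighted AL5 is open") in the case `|S| = 1`, and for `|S| ≥ 2` (block `S` glued,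
`x' ∈ S`) whenever `τ_{u/S}(a₀) ≤ τ_{u/S}(a)` on the relay neighbours of `x'`.

**Proof** (this file).  Let `F = {s(x,a) : a ∈ T}` and decompose over the `2^F` patterns of `F`
(`prodBernoulli_real_inter_eq_sum_pinW`): `μ_w(R ∩ {v ↔ b}) = Σ_{∅ ≠ J ⊆ F} μ_w([J]_F) · τ_J(v)` and
`μ_w(Rᶜ ∩ {v ↔ b}) = μ_w([∅]_F) · τ⁰(v)`, `τ_J` the reliability under the pinned weighting `pinW w F J`
(`1` on `J`, `0` on `F ∖ J`).  Let `c` minimise `τ⁰` over `{d} ∪ T`.  (i) For every `J ≠ ∅`, picking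
`s(x,a) ∈ J`: `τ⁰(c) ≤ τ⁰(a)`, and the pinned weighting `pinW w F J` is `w⁰` with the star edges `J` glued,
so the GLUING FORM OF LEMMA 5 for a star (`starGlue_lemma5`, the proof of the landed `stub_gluingLemma5`
verbatim with `D = J`) gives `τ_J(c) ≤ τ_J(a) ≤ τ_J(x)`.  (ii) `τ⁰(c) ≤ τ⁰(d)` and `τ(d) ≤ τ(c)` (hypothesis if
`c ∈ T`).  Hence `μ(R, d↔b) = τ(d) − μ([∅])τ⁰(d) ≤ τ(c) − μ([∅])τ⁰(c) = Σ_{J≠∅} μ([J]) τ_J(c) ≤ Σ_{J≠∅} μ([J]) τ_J(x)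
= μ(R, x↔b)`.
[cite: KozmaNitzan2024, Lemma 3(i) (pp. 6–7), Lemma 5 (p. 13); VandenbergHaggstromKahn2005, Thms. 1.3–1.4]
-/

namespace Summit.CriticalPhenomena.PercolationContinuityZ3.Theorems

open MeasureTheory Set
open Literature.Probability.LatticeModels (prodBernoulli)
open Literature.Probability.Percolation (BondConfig openConn openGraph openEdgeCluster pinW localCylinder
  DeterminedBy determinedBy_iff)

noncomputable section
open Classical

section MultiEdgeLemma3

open Filter Topology Literature.Probability.LatticeModels Literature.Probability.Percolation

variable {n : ℕ}

/-- The event "all edges of a STAR set `D` at `x` are open" is increasing in the open edge cluster `C_v`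
of every endpoint `v` (`s(x,v) ∈ D`): each edge of `D` is open, non-loop, and both ends are joined to `v`
through `x`.  (Star analogue of `gluingLemma5_allOpen_mono`.) [cite: KozmaNitzan2024, §3.2 p. 14] -/
theorem starGlue_allOpen_mono {x : Fin n} {D : Finset (Sym2 (Fin n))}
    (hD : ∀ e ∈ D, ∃ a, a ≠ x ∧ e = s(x, a)) {v : Fin n} (hv : s(x, v) ∈ D) (hvx : v ≠ x) :
    ∀ ω ω' : Set (Sym2 (Fin n)),
      ω ∈ {ω : Set (Sym2 (Fin n)) | (↑D : Set (Sym2 (Fin n))) ⊆ ω} →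
        openEdgeCluster ω v ⊆ openEdgeCluster ω' v →
          ω' ∈ {ω : Set (Sym2 (Fin n)) | (↑D : Set (Sym2 (Fin n))) ⊆ ω} := by
  intro ω ω' hω hsub e heD
  refine openEdgeCluster_subset ω' v (hsub ?_)
  rw [mem_openEdgeCluster_iff]
  obtain ⟨a, hax, rfl⟩ := hD e (Finset.mem_coe.1 heD)
  have hvx' : (openGraph ω).Reachable v x := by
    refine SimpleGraph.Adj.reachable ((openGraph_adj ω v x).2 ⟨?_, hvx⟩)
    rw [Sym2.eq_swap]
    exact hω (Finset.mem_coe.2 hv)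
  refine ⟨hω heD, fun h => hax (Sym2.mk_isDiag_iff.1 h).symm, fun y hy => ?_⟩
  rcases Sym2.mem_iff.1 hy with rfl | rfl
  · exact hvx'
  · exact hvx'.trans (SimpleGraph.Adj.reachable ((openGraph_adj ω x y).2 ⟨hω heD, hax.symm⟩))

/-- **Gluing form of KN Lemma 5 for a star** (the proof of the landed `stub_gluingLemma5` verbatim, with the
clique pairs replaced by a star set `D` of edges at `x`): if `μ_w(c ↔ b) ≤ μ_w(v ↔ b)` for an endpoint `v` of
`D` (`s(x,v) ∈ D`), then after GLUING the star (`weight 1` on `D`) `μ_glue(c ↔ b) ≤ μ_glue(v ↔ b)`.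
Sprinkle `ε` on `D`, apply `knLemma3i` to the increasing `C_v`-event "all of `D` open", condition (= glue,
`gluingLemma5_real_inter_allOpen`), let `ε → 0` (`stub_weightContinuity`).
[cite: KozmaNitzan2024, Lemma 5 (p. 13), Lemma 3(i) (pp. 6–7)] -/
theorem starGlue_lemma5 (w : Sym2 (Fin n) → unitInterval) (x : Fin n) (D : Finset (Sym2 (Fin n)))
    (hD : ∀ e ∈ D, ∃ a, a ≠ x ∧ e = s(x, a)) (c v b : Fin n) (hv : s(x, v) ∈ D) (hvx : v ≠ x)
    (hle : (prodBernoulli w).real (openConn c b) ≤ (prodBernoulli w).real (openConn v b)) :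
    (prodBernoulli (fun e : Sym2 (Fin n) => if e ∈ D then 1 else w e)).real (openConn c b) ≤
      (prodBernoulli (fun e : Sym2 (Fin n) => if e ∈ D then 1 else w e)).real (openConn v b) := by
  set g : Sym2 (Fin n) → unitInterval := fun e => if e ∈ D then 1 else w e with hg
  set E : Set (BondConfig (Fin n)) := {ω | (↑D : Set (Sym2 (Fin n))) ⊆ ω} with hEdef
  -- the sprinkled weights `w_ε`
  set u : unitInterval → Sym2 (Fin n) → unitInterval :=
    fun ε e => if e ∈ D then Set.Icc.convexComb (w e) 1 ε else w e with hu
  have hwu : ∀ ε, w ≤ u ε := by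
    intro ε e
    by_cases he : e ∈ D
    · simp only [hu, he, if_true]
      exact Set.Icc.le_convexComb unitInterval.le_one' ε
    · simp only [hu, he, if_false]
      exact le_rfl
  have hu0 : u 0 = w := by
    funext e
    by_cases he : e ∈ D
    · simp only [hu, he, if_true, Set.Icc.convexComb_zero]
    · simp only [hu, he, if_false]
  have hucont : Continuous u := by
    refine continuous_pi fun e => ?_
    by_cases he : e ∈ D
    · simp only [hu, he, if_true]
      exact Set.Icc.continuous_convexComb (w e) 1
    · simp only [hu, he, if_false]
      exact continuous_const
  -- gluing `u ε` along `D` gives `g`, whatever `ε`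
  have hpin : ∀ ε, (fun e => if e ∈ D then (1 : unitInterval) else u ε e) = g := by
    intro ε
    funext e
    by_cases he : e ∈ D
    · simp only [hg, he, if_true]
    · simp only [hg, hu, he, if_false]
  -- conditioning on `E` is gluing
  have hcond : ∀ ε (X : Set (BondConfig (Fin n))),
      (prodBernoulli (u ε)).real (X ∩ E) =
        (prodBernoulli (u ε)).real E * (prodBernoulli g).real X := by
    intro ε X
    rw [hEdef, gluingLemma5_real_inter_allOpen (u ε) D MeasurableSet.of_discrete, hpin ε]
  -- `E` has positive probability under `u ε`, `ε > 0`
  have hpos : ∀ ε : unitInterval, 0 < (ε : ℝ) → 0 < (prodBernoulli (u ε)).real E := by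
    intro ε hε
    rw [hEdef, prodBernoulli_real_subset (u ε) D]
    refine Finset.prod_pos fun e he => ?_
    simp only [hu, he, if_true, Set.Icc.coe_convexComb, Set.Icc.coe_one, mul_one]
    exact add_pos_of_nonneg_of_pos
      (mul_nonneg (unitInterval.one_minus_nonneg ε) (unitInterval.nonneg (w e))) hε
  -- the step at fixed `ε > 0`
  have hstep : ∀ ε : unitInterval, 0 < (ε : ℝ) →
      (prodBernoulli g).real (openConn c b) ≤ (prodBernoulli g).real (openConn v b) +
        ((prodBernoulli (u ε)).real (openConn c b) - (prodBernoulli w).real (openConn c b)) := by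
    intro ε hε
    have hma : (prodBernoulli w).real (openConn c b) ≤ (prodBernoulli (u ε)).real (openConn c b) :=
      prodBernoulli_real_mono_of_isUpperSet (hwu ε) (isUpperSet_openConn c b)
        MeasurableSet.of_discrete
    have hmv : (prodBernoulli w).real (openConn v b) ≤ (prodBernoulli (u ε)).real (openConn v b) :=
      prodBernoulli_real_mono_of_isUpperSet (hwu ε) (isUpperSet_openConn v b)
        MeasurableSet.of_discrete
    have h3 := knLemma3i n (u ε) c v b E
      ((prodBernoulli (u ε)).real (openConn c b) - (prodBernoulli w).real (openConn c b))
      (starGlue_allOpen_mono hD hv hvx) (sub_nonneg.2 hma) (by linarith)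
    rw [hcond ε (openConn c b), hcond ε (openConn v b)] at h3
    refine le_of_mul_le_mul_left (h3.trans_eq ?_) (hpos ε hε)
    ring
  -- `ε → 0`
  obtain ⟨ε, hεpos, hεlim⟩ := gluingLemma5_exists_seq_tendsto_zero
  have hF : Continuous fun t : unitInterval => (prodBernoulli (u t)).real (openConn c b) :=
    (stub_weightContinuity n (openConn c b)).comp hucont
  have hlim : Tendsto (fun k => (prodBernoulli g).real (openConn v b) +
      ((prodBernoulli (u (ε k))).real (openConn c b) - (prodBernoulli w).real (openConn c b)))
      atTop (𝓝 ((prodBernoulli g).real (openConn v b) +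
        ((prodBernoulli (u 0)).real (openConn c b) - (prodBernoulli w).real (openConn c b)))) :=
    tendsto_const_nhds.add (((hF.tendsto 0).comp hεlim).sub tendsto_const_nhds)
  rw [hu0, sub_self, add_zero] at hlim
  exact ge_of_tendsto' hlim fun k => hstep (ε k) (hεpos k)

/-- Under a weighting giving the edge `x–v` weight `1`, `{v ↔ b} ⊆ {x ↔ b}` almost surely, hence
`μ(v ↔ b) ≤ μ(x ↔ b)` (local copy of `real_openConn_le_of_weight_one` of `…BlockKernelGoodNeighbour.lean`, not imported to keep
the import closure small). [folklore] -/
private theorem medge_openConn_le_of_weight_one (p : Sym2 (Fin n) → unitInterval) {x v : Fin n} (b : Fin n)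
    (h1 : p s(x, v) = 1) (hvx : v ≠ x) :
    (prodBernoulli p).real (openConn v b) ≤ (prodBernoulli p).real (openConn x b) := by
  have hae := prodBernoulli_ae_mem_of_eq_one p h1
  have heq : (openConn v b : Set (BondConfig (Fin n))) =ᵐ[prodBernoulli p]
      (openConn v b ∩ {ω | s(x, v) ∈ ω} : Set (BondConfig (Fin n))) := by
    filter_upwards [hae] with ω hω
    exact propext ⟨fun h => ⟨h, hω⟩, fun h => h.1⟩
  rw [measureReal_congr heq]
  refine measureReal_mono ?_ (measure_ne_top _ _)
  rintro ω ⟨hvb, hω⟩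
  exact SimpleGraph.Reachable.trans
    (SimpleGraph.Adj.reachable ((openGraph_adj ω x v).2 ⟨hω, hvx.symm⟩)) hvb

/-- Pinning `F` along a pattern `J ⊆ F` is gluing the edges of `J` on top of pinning `F` along `∅`:
`pinW w F J = (1 on J, pinW w F ∅ elsewhere)`. [folklore] -/
theorem pinW_eq_ite_pinW_empty (w : Sym2 (Fin n) → unitInterval) {F J : Finset (Sym2 (Fin n))}
    (hJF : J ⊆ F) :
    pinW w (↑F : Set (Sym2 (Fin n))) ↑J =
      fun e => if e ∈ J then (1 : unitInterval) else pinW w ↑F ↑(∅ : Finset (Sym2 (Fin n))) e := by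
  funext e
  by_cases heJ : e ∈ J
  · rw [if_pos heJ, pinW_apply_of_mem_of_mem w (Finset.mem_coe.2 (hJF heJ)) (Finset.mem_coe.2 heJ)]
  · rw [if_neg heJ]
    by_cases heF : e ∈ F
    · rw [pinW_apply_of_mem_of_not_mem w (Finset.mem_coe.2 heF) (fun h => heJ (Finset.mem_coe.1 h)),
        pinW_apply_of_mem_of_not_mem w (Finset.mem_coe.2 heF) (by simp)]
    · rw [pinW_apply_of_not_mem w _ (fun h => heF (Finset.mem_coe.1 h)),
        pinW_apply_of_not_mem w _ (fun h => heF (Finset.mem_coe.1 h))]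

/-- **Core of the multi-edge Lemma 3**: if `c` is at most as reliable as the endpoint `a` of an edge
`s(x,a) ∈ J ⊆ F` under the weighting with the star `F` removed, then under the weighting with the star
pinned along `J` (edges of `J` open, of `F ∖ J` closed) `c` is at most as reliable as `x`.
[cite: KozmaNitzan2024, Lemma 5 (p. 13)] -/
theorem multiEdge_core (w : Sym2 (Fin n) → unitInterval) {x : Fin n} {F J : Finset (Sym2 (Fin n))}
    (hF : ∀ e ∈ F, ∃ a, a ≠ x ∧ e = s(x, a)) (hJF : J ⊆ F) {a : Fin n} (haJ : s(x, a) ∈ J) (hax : a ≠ x)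
    (c b : Fin n)
    (hle : (prodBernoulli (pinW w (↑F : Set (Sym2 (Fin n))) ↑(∅ : Finset (Sym2 (Fin n))))).real (openConn c b) ≤
      (prodBernoulli (pinW w (↑F : Set (Sym2 (Fin n))) ↑(∅ : Finset (Sym2 (Fin n))))).real (openConn a b)) :
    (prodBernoulli (pinW w (↑F : Set (Sym2 (Fin n))) ↑J)).real (openConn c b) ≤
      (prodBernoulli (pinW w (↑F : Set (Sym2 (Fin n))) ↑J)).real (openConn x b) := by
  have hD : ∀ e ∈ J, ∃ a, a ≠ x ∧ e = s(x, a) := fun e he => hF e (hJF he)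
  rw [pinW_eq_ite_pinW_empty w hJF]
  refine (starGlue_lemma5 (pinW w ↑F ↑(∅ : Finset (Sym2 (Fin n)))) x J hD c a b haJ hax hle).trans ?_
  refine medge_openConn_le_of_weight_one _ b ?_ hax
  simp only [haJ, if_true]

/-- The complement of "some edge of `F` is open" is determined by `F` (from the landed
`DepthOneGluing.determinedBy_exists_mem`). [folklore; Grimmett 1999 §2.2] -/
theorem determinedBy_forall_not_mem (F : Finset (Sym2 (Fin n))) :
    DeterminedBy {ω : Set (Sym2 (Fin n)) | ∃ e ∈ F, e ∈ ω}ᶜ (↑F : Set (Sym2 (Fin n))) := by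
  rw [determinedBy_iff]
  intro ω ω' h
  have := (determinedBy_iff _ _).1 (DepthOneGluing.determinedBy_exists_mem F) ω ω' h
  simp only [Set.mem_compl_iff]
  exact not_congr this

/-- **Multi-edge form of Kozma–Nitzan's Lemma 3(i)** (= the lead's AL5 at `|S| = 1`).  Let `x ∉ T`,
`τ(d) ≤ τ(a)` for every `a ∈ T`, and `R = {ω | some edge s(x,a), a ∈ T, is open}`.  Then
`μ_w(R ∩ {d ↔ b}) ≤ μ_w(R ∩ {x ↔ b})`: on the event that `x` has an open edge into `T`, the vertex `x`
is at least as likely as `d` to be joined to `b`.  (For `|T| = 1` this is Lemma 3(i) with `Q = {x–a open}`;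
the union over `T` is NOT a consequence of the single-edge instances — see the module docstring for the
proof via the pattern decomposition and the star gluing form of Lemma 5.)
[cite: KozmaNitzan2024, Lemma 3(i) (pp. 6–7), Lemma 5 (p. 13)] -/
theorem multiEdge_lemma3 (w : Sym2 (Fin n) → unitInterval) (x d b : Fin n) (T : Finset (Fin n))
    (hxT : x ∉ T)
    (hle : ∀ a ∈ T, (prodBernoulli w).real (openConn d b) ≤ (prodBernoulli w).real (openConn a b)) :
    (prodBernoulli w).real ({ω : Set (Sym2 (Fin n)) | ∃ a ∈ T, s(x, a) ∈ ω} ∩ openConn d b) ≤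
      (prodBernoulli w).real ({ω : Set (Sym2 (Fin n)) | ∃ a ∈ T, s(x, a) ∈ ω} ∩ openConn x b) := by
  -- the star `F` and the event `R`
  set F : Finset (Sym2 (Fin n)) := T.image (fun a => s(x, a)) with hFdef
  have hF : ∀ e ∈ F, ∃ a, a ≠ x ∧ e = s(x, a) := by
    intro e he
    obtain ⟨a, haT, rfl⟩ := Finset.mem_image.1 he
    exact ⟨a, fun h => hxT (h ▸ haT), rfl⟩
  have hR : {ω : Set (Sym2 (Fin n)) | ∃ a ∈ T, s(x, a) ∈ ω} = {ω | ∃ e ∈ F, e ∈ ω} := by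
    ext ω
    simp only [Set.mem_setOf_eq, hFdef, Finset.mem_image]
    constructor
    · rintro ⟨a, haT, ha⟩; exact ⟨s(x, a), ⟨a, haT, rfl⟩, ha⟩
    · rintro ⟨e, ⟨a, haT, rfl⟩, he⟩; exact ⟨a, haT, he⟩
  rw [hR]
  set R : Set (Set (Sym2 (Fin n))) := {ω | ∃ e ∈ F, e ∈ ω} with hRdef
  -- base weighting `w⁰` (star removed) and the minimiser `c` of `τ⁰` over `{d} ∪ T`
  set w₀ : Sym2 (Fin n) → unitInterval := pinW w ↑F ↑(∅ : Finset (Sym2 (Fin n))) with hw₀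
  set τ₀ : Fin n → ℝ := fun v => (prodBernoulli w₀).real (openConn v b) with hτ₀
  obtain ⟨c, hc, hcmin⟩ := Finset.exists_min_image (insert d T) τ₀ (Finset.insert_nonempty d T)
  have hcT : ∀ a ∈ T, τ₀ c ≤ τ₀ a := fun a ha => hcmin a (Finset.mem_insert_of_mem ha)
  have hcd : τ₀ c ≤ τ₀ d := hcmin d (Finset.mem_insert_self d T)
  have hdc : (prodBernoulli w).real (openConn d b) ≤ (prodBernoulli w).real (openConn c b) := by
    rcases Finset.mem_insert.1 hc with rfl | hcT'
    · exact le_rfl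
    · exact hle c hcT'
  -- (i) CORE on every pattern meeting `R`
  have hcore : ∀ J : Finset (Sym2 (Fin n)), J ⊆ F → (↑J : Set (Sym2 (Fin n))) ∈ R →
      (prodBernoulli (pinW w ↑F ↑J)).real (openConn c b) ≤
        (prodBernoulli (pinW w ↑F ↑J)).real (openConn x b) := by
    intro J hJF hJR
    obtain ⟨e, heF, heJ⟩ := hJR
    have heJ' : e ∈ J := Finset.mem_coe.1 heJ
    obtain ⟨a, hax, rfl⟩ := hF e heF
    have haT : a ∈ T := by
      obtain ⟨a', ha'T, he'⟩ := Finset.mem_image.1 heF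
      rcases Sym2.eq_iff.1 he' with ⟨-, h⟩ | ⟨h, -⟩
      · exact h ▸ ha'T
      · exact (hax h.symm).elim
    exact multiEdge_core w hF hJF heJ' hax c b (hcT a haT)
  -- law of total probability over the patterns of `F`, for `R` and for `Rᶜ`
  have hRm : MeasurableSet R := MeasurableSet.of_discrete
  have hdec := fun v : Fin n =>
    prodBernoulli_real_inter_eq_sum_pinW w F (A := openConn v b) (B := R) MeasurableSet.of_discrete
      (DepthOneGluing.determinedBy_exists_mem F)
  have hdecC := fun v : Fin n =>
    prodBernoulli_real_inter_eq_sum_pinW w F (A := openConn v b) (B := Rᶜ) MeasurableSet.of_discrete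
      (determinedBy_forall_not_mem F)
  have hN : ∀ v : Fin n, (prodBernoulli w).real (openConn v b ∩ Rᶜ) =
      (prodBernoulli w).real (localCylinder ↑F ↑(∅ : Finset (Sym2 (Fin n)))) * τ₀ v := by
    intro v
    rw [hdecC v]
    refine Finset.sum_eq_single_of_mem ∅ ?_ ?_
    · refine (@Finset.mem_filter _ _ (_) _ _).2 ⟨Finset.mem_powerset.2 (Finset.empty_subset F), ?_⟩
      rintro ⟨e, -, he⟩
      exact Finset.notMem_empty e (Finset.mem_coe.1 he)
    · intro J hJ hne
      exfalso
      obtain ⟨hJF, hno⟩ := (@Finset.mem_filter _ _ (_) _ _).1 hJ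
      obtain ⟨e, heJ⟩ := Finset.nonempty_iff_ne_empty.2 hne
      exact hno ⟨e, Finset.mem_powerset.1 hJF heJ, Finset.mem_coe.2 heJ⟩
  have hsplit : ∀ v : Fin n, (prodBernoulli w).real (openConn v b ∩ R) +
      (prodBernoulli w).real (openConn v b ∩ Rᶜ) = (prodBernoulli w).real (openConn v b) :=
    fun v => measureReal_inter_add_sdiff (μ := prodBernoulli w) (s := openConn v b) hRm
  -- (ii) `μ(c↔b, R) ≤ μ(x↔b, R)` termwise
  have hcx : (prodBernoulli w).real (openConn c b ∩ R) ≤ (prodBernoulli w).real (openConn x b ∩ R) := by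
    rw [hdec c, hdec x]
    refine Finset.sum_le_sum fun J hJ => mul_le_mul_of_nonneg_left ?_ measureReal_nonneg
    obtain ⟨hJF, hJR⟩ := (@Finset.mem_filter _ _ (_) _ _).1 hJ
    exact hcore J (Finset.mem_powerset.1 hJF) hJR
  -- (iii) `μ(d↔b, R) ≤ μ(c↔b, R)` from `τ(d) ≤ τ(c)` and `τ⁰(c) ≤ τ⁰(d)`
  have hdc' : (prodBernoulli w).real (openConn d b ∩ R) ≤ (prodBernoulli w).real (openConn c b ∩ R) := by
    have hd := hsplit d
    have hc' := hsplit c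
    rw [hN] at hd hc'
    have hmono : (prodBernoulli w).real (localCylinder ↑F ↑(∅ : Finset (Sym2 (Fin n)))) * τ₀ c ≤
        (prodBernoulli w).real (localCylinder ↑F ↑(∅ : Finset (Sym2 (Fin n)))) * τ₀ d :=
      mul_le_mul_of_nonneg_left hcd measureReal_nonneg
    linarith
  rw [Set.inter_comm R (openConn d b), Set.inter_comm R (openConn x b)]
  exact hdc'.trans hcx

/-- **Multi-edge Lemma 3 for the relay neighbours of a vertex** (the lead's AL5 / `X1 ≥ 0` at `|S| = 1`, in the
crux's vocabulary): `a₀` any vertex with `μ(a₀ ↔ b) ≤ μ(a ↔ b)` for all `a ∈ A` (e.g. the minimiser over `A ∋ a₀`), `x ∉ A`; with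
`R = {some edge x–a, a ∈ A, open}`: `μ(R ∩ {a₀ ↔ b}) ≤ μ(R ∩ {x ↔ b})` — on its relay layers the
non-relay vertex `x` beats the global minimiser. [cite: KozmaNitzan2024, Lemma 3(i) (pp. 6–7), §3.2 pp. 12–14] -/
theorem multiEdge_lemma3_relays (w : Sym2 (Fin n) → unitInterval) (A : Finset (Fin n)) (x a₀ b : Fin n)
    (hx : x ∉ A)
    (hmin : ∀ a ∈ A, (prodBernoulli w).real (openConn a₀ b) ≤ (prodBernoulli w).real (openConn a b)) :
    (prodBernoulli w).real ({ω : Set (Sym2 (Fin n)) | ∃ a ∈ A, s(x, a) ∈ ω} ∩ openConn a₀ b) ≤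
      (prodBernoulli w).real ({ω : Set (Sym2 (Fin n)) | ∃ a ∈ A, s(x, a) ∈ ω} ∩ openConn x b) := by
  exact multiEdge_lemma3 w x a₀ b A hx hmin

/-- Registered rung `stub_multiEdgeLemma3_b` of crux stmt-CriticalPhenomena-4576 (seat b, correlation inequalities): the multi-edge
Lemma 3(i) `μ(R ∩ {d ↔ b}) ≤ μ(R ∩ {x ↔ b})`, `R` = some edge `x–T` open, under `x ∉ T` and `τ(d) ≤ τ(a)` on `T` —
`multiEdge_lemma3`, closed statement. [cite: KozmaNitzan2024, Lemma 3(i) (pp. 6–7), Lemma 5 (p. 13)] -/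
theorem stub_multiEdgeLemma3_b : ∀ (n : ℕ) (w : Sym2 (Fin n) → unitInterval) (T : Finset (Fin n)) (x d b : Fin n), x ∉ T → (∀ a ∈ T, (Literature.Probability.LatticeModels.prodBernoulli w).real (Literature.Probability.Percolation.openConn d b) ≤ (Literature.Probability.LatticeModels.prodBernoulli w).real (Literature.Probability.Percolation.openConn a b)) → (Literature.Probability.LatticeModels.prodBernoulli w).real ({ω : Set (Sym2 (Fin n)) | ∃ a ∈ T, s(x, a) ∈ ω} ∩ Literature.Probability.Percolation.openConn d b) ≤ (Literature.Probability.LatticeModels.prodBernoulli w).real ({ω : Set (Sym2 (Fin n)) | ∃ a ∈ T, s(x, a) ∈ ω} ∩ Literature.Probability.Percolation.openConn x b) :=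
  fun _ w T x d b hxT hle => multiEdge_lemma3 w x d b T hxT hle

end MultiEdgeLemma3

end

end Summit.CriticalPhenomena.PercolationContinuityZ3.Theorems
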